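import Summits.CriticalPhenomena.PercolationContinuityZ3.Theorems.PercNearOneGluingNoHeavyLowerTailSahiGridPatternDiagCert

/-!
# `NoHeavyLowerTail` (crux stmt-CriticalPhenomena-4575), Sahi programme P1: **DIAGONAL CERTIFICATES LIFT ALONG FREE COORDINATES** —
# if `d` certifies `V ⊆ [3]^k` then `2^n · d ∘ cellOf` certifies the cylinder `V × [3]^n ⊆ [3]^{n+k}`

Support file (Sahi cell, seat `prim-sahi-p1`, generation 16; `--supports stmt-CriticalPhenomena-4575`).  Pure proofs, NO definitions, no `sorry`,
standard axioms.  Vocabulary of `…SahiGridPattern{CellForm,CellAtoms,RectCert,DiagCert}`.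

THE MATHEMATICS.  A diagonal certificate for a first slot `V ⊆ [3]^k` is `d ≥ 0` on `[3]^k` with (T) `Σ_{q∈W} d(q) ≤ Σ_{q∈W} λ_V(q)` for every
up-set `W` and (N) `Θ_V(A×A′) ≤ Σ_{q∈A∩A′} d(q)` for all up-sets `A, A′` (`…DiagCert`: it proves `V × [3]^m` good in every dimension).  THIS FILE:
the certificate notion is CLOSED UNDER CYLINDERS — `d′(x) := 2^n · d(cellOf x)` satisfies (T) and (N) for `cylSet V ⊆ [3]^{n+k}`
(**`diagCert_cylSet_lift`**), so `(†_diag)_k(V) ⟹ (†_diag)_{n+k}(V × [3]^n)` (**`exists_diagCert_cylSet`**).  Proof: `λ_{V×[3]^n}(ξ,q) = 2^n λ_V(q)`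
and (T) on each section `W^ξ`; for (N), `Σ_{A×B} Θ_{V×[3]^n} = pairN(Θ_V) = Σ_{ξ δ̸ η} Θ_V(A^ξ × B^η) ≤ Σ_{ξ δ̸ η} d(A^ξ ∩ B^η) = pairN(diag d)
≤ pairT(diag d) = 2^n Σ_ξ d(A^ξ ∩ B^ξ)` — (N) on the section pairs, then coefficientwise Harris on the fibres weighted by `d ≥ 0`
(`pairN_le_pairT_of_nonneg`).  (For the dimension count: with the k ≤ 3 certificates — all 3 + 19 + 979 nonempty up-sets, seat computation,
two engines — every cylinder over a ≤ 3-dimensional up-set carries an explicit diagonal certificate in every dimension.)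
Nothing here asserts `(†_diag)_k(U)` for any particular `U`. [this work]
-/

namespace Summit.CriticalPhenomena.PercolationContinuityZ3.Theorems.SahiGridPattern

open Finset SahiGrid3
open scoped BigOperators

variable {n k : ℕ}

/-- A sum over a subset of `[3]^{n+k}` as a sum over its sections: `Σ_{x∈W} F(x) = Σ_ξ Σ_{q ∈ W^ξ} F(glue ξ q)`. [this work] -/
theorem sum_mem_eq_sum_sect (W : Finset (Pd (n + k))) (F : Pd (n + k) → ℤ) :
    (∑ x ∈ W, F x) = ∑ ξ : Pd n, ∑ q ∈ sect W ξ, F (glue ξ q) := by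
  rw [← sum_ind_mul_eq_sum_mem W F, sum_glue]
  refine Finset.sum_congr rfl fun ξ _ => ?_
  rw [← sum_ind_mul_eq_sum_mem (sect W ξ) (fun q => F (glue ξ q))]
  refine Finset.sum_congr rfl fun q _ => ?_
  rw [ind_sect]

/-- Sections of an intersection. [this work] -/
theorem sect_inter (A B : Finset (Pd (n + k))) (ξ : Pd n) : sect (A ∩ B) ξ = sect A ξ ∩ sect B ξ := by
  unfold sect
  ext q
  simp only [mem_filter, mem_inter, mem_univ, true_and]

/-- `λ` of a cylinder: `λ_{V×[3]^n}(glue ξ q) = 2^n · λ_V(q)`. [this work] -/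
theorem lamU_cylSet_glue (V : Finset (Pd k)) (ξ : Pd n) (q : Pd k) :
    lamU (cylSet V : Finset (Pd (n + k))) (glue ξ q) = 2 ^ n * lamU V q := by
  unfold lamU
  rw [ind_cylSet_glue, nuCount_cylSet, pow_add]
  ring

/-- The `Θ` double sum of a cylinder over `A × B` is the `pairN` pairing of `Θ_V` with the cell statistics of `A, B`. [this work] -/
theorem sum_sum_thetaVal_cylSet (V : Finset (Pd k)) (A B : Finset (Pd (n + k))) :
    (∑ x ∈ A, ∑ y ∈ B, thetaVal (cylSet V : Finset (Pd (n + k))) x y) = pairN (thetaVal V) A B := by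
  rw [sum_sum_mem_eq_ind, pairN_expand, sum_glue]
  refine Finset.sum_congr rfl fun ξ _ => ?_
  have e : ∀ q : Pd k, (∑ y : Pd (n + k), ind A (glue ξ q) * ind B y * thetaVal (cylSet V : Finset (Pd (n + k))) (glue ξ q) y) =
      ∑ η : Pd n, ∑ r : Pd k, ind A (glue ξ q) * ind B (glue η r) * thetaVal (cylSet V : Finset (Pd (n + k))) (glue ξ q) (glue η r) :=
    fun q => sum_glue _
  simp_rw [e, thetaVal_cylSet]
  rw [Finset.sum_comm]
  refine Finset.sum_congr rfl fun η _ => ?_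
  rw [Finset.mul_sum]
  refine Finset.sum_congr rfl fun q _ => ?_
  rw [Finset.mul_sum]
  refine Finset.sum_congr rfl fun r _ => ?_
  ring

/-- **DIAGONAL CERTIFICATES LIFT ALONG FREE COORDINATES** (every `k`, `n`): if `d ≥ 0` satisfies (T) and (N) for `V ⊆ [3]^k`, then
`x ↦ 2^n · d(cellOf x)` satisfies (T) and (N) for the cylinder `V × [3]^n ⊆ [3]^{n+k}`. [this work] -/
theorem diagCert_cylSet_lift (V : Finset (Pd k)) (d : Pd k → ℤ) (hd : ∀ q, 0 ≤ d q)
    (hT : ∀ W : Finset (Pd k), IsUpperSet (W : Set (Pd k)) → (∑ q ∈ W, d q) ≤ ∑ q ∈ W, lamU V q)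
    (hN : ∀ A A' : Finset (Pd k), IsUpperSet (A : Set (Pd k)) → IsUpperSet (A' : Set (Pd k)) →
      (∑ q ∈ A, ∑ r ∈ A', thetaVal V q r) ≤ ∑ q ∈ A ∩ A', d q) :
    (∀ W : Finset (Pd (n + k)), IsUpperSet (W : Set (Pd (n + k))) →
        (∑ x ∈ W, 2 ^ n * d (cellOf x)) ≤ ∑ x ∈ W, lamU (cylSet V : Finset (Pd (n + k))) x) ∧
    (∀ A B : Finset (Pd (n + k)), IsUpperSet (A : Set (Pd (n + k))) → IsUpperSet (B : Set (Pd (n + k))) →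
        (∑ x ∈ A, ∑ y ∈ B, thetaVal (cylSet V : Finset (Pd (n + k))) x y) ≤ ∑ x ∈ A ∩ B, 2 ^ n * d (cellOf x)) := by
  refine ⟨fun W hW => ?_, fun A B hA hB => ?_⟩
  · rw [sum_mem_eq_sum_sect W (fun x => (2 : ℤ) ^ n * d (cellOf x)),
      sum_mem_eq_sum_sect W (fun x => lamU (cylSet V : Finset (Pd (n + k))) x)]
    refine Finset.sum_le_sum fun ξ _ => ?_
    simp only [cellOf_glue, lamU_cylSet_glue]
    rw [← Finset.mul_sum, ← Finset.mul_sum]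
    exact mul_le_mul_of_nonneg_left (hT _ (isUpperSet_sect hW ξ)) (pow_nonneg (by norm_num) n)
  · rw [sum_sum_thetaVal_cylSet]
    have h1 : pairN (thetaVal V) A B ≤ pairN (fun q r => if q = r then d q else 0) A B := by
      rw [pairN_eq_sum_sect, pairN_eq_sum_sect]
      refine Finset.sum_le_sum fun ξ _ => Finset.sum_le_sum fun η _ => mul_le_mul_of_nonneg_left ?_ ?_
      · rw [sum_sum_ite_eq_diag]
        exact hN _ _ (isUpperSet_sect hA ξ) (isUpperSet_sect hB η)
      · split_ifs <;> norm_num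
    have h2 : pairN (fun q r => if q = r then d q else 0) A B ≤ pairT (fun q r => if q = r then d q else 0) A B :=
      pairN_le_pairT_of_nonneg (fun q r => by
        show 0 ≤ (if q = r then d q else 0)
        split_ifs
        · exact hd q
        · exact le_rfl) hA hB
    have h3 : pairT (fun q r => if q = r then d q else 0) A B = ∑ x ∈ A ∩ B, 2 ^ n * d (cellOf x) := by
      rw [pairT_eq_sum_sect, sum_mem_eq_sum_sect (A ∩ B) (fun x => (2 : ℤ) ^ n * d (cellOf x)), Finset.mul_sum]
      refine Finset.sum_congr rfl fun ξ _ => ?_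
      rw [sum_sum_ite_eq_diag, sect_inter, Finset.mul_sum]
      refine Finset.sum_congr rfl fun q _ => ?_
      rw [cellOf_glue]
    linarith

/-- **`(†_diag)_k(V) ⟹ (†_diag)_{n+k}(V × [3]^n)`**: the existence of a diagonal certificate is inherited by every cylinder. [this work] -/
theorem exists_diagCert_cylSet (V : Finset (Pd k))
    (hex : ∃ d : Pd k → ℤ, (∀ q, 0 ≤ d q) ∧
      (∀ W : Finset (Pd k), IsUpperSet (W : Set (Pd k)) → (∑ q ∈ W, d q) ≤ ∑ q ∈ W, lamU V q) ∧
      (∀ A A' : Finset (Pd k), IsUpperSet (A : Set (Pd k)) → IsUpperSet (A' : Set (Pd k)) →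
        (∑ q ∈ A, ∑ r ∈ A', thetaVal V q r) ≤ ∑ q ∈ A ∩ A', d q)) :
    ∃ d' : Pd (n + k) → ℤ, (∀ x, 0 ≤ d' x) ∧
      (∀ W : Finset (Pd (n + k)), IsUpperSet (W : Set (Pd (n + k))) →
        (∑ x ∈ W, d' x) ≤ ∑ x ∈ W, lamU (cylSet V : Finset (Pd (n + k))) x) ∧
      (∀ A B : Finset (Pd (n + k)), IsUpperSet (A : Set (Pd (n + k))) → IsUpperSet (B : Set (Pd (n + k))) →
        (∑ x ∈ A, ∑ y ∈ B, thetaVal (cylSet V : Finset (Pd (n + k))) x y) ≤ ∑ x ∈ A ∩ B, d' x) := by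
  obtain ⟨d, hd, hT, hN⟩ := hex
  obtain ⟨hT', hN'⟩ := diagCert_cylSet_lift (n := n) V d hd hT hN
  exact ⟨fun x => 2 ^ n * d (cellOf x), fun x => mul_nonneg (pow_nonneg (by norm_num) n) (hd _), hT', hN'⟩

end Summit.CriticalPhenomena.PercolationContinuityZ3.Theorems.SahiGridPattern
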